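import Literature.MathematicalPhysics.QuantumFieldTheory.VillainAngleIntegral
import Literature.MathematicalPhysics.QuantumFieldTheory.VillainCoboundaryMatrix
import Mathlib.MeasureTheory.Integral.DominatedConvergence
import HarnessLib

/-!
# The duality transformation of the Villain `U(1)` theory on a cube: Wilson loops as
# spin-wave factor times a Coulomb-gas average over integer fluxes

The first step of Fröhlich–Spencer's proof of the perimeter law (FS82 §2.1 (i) "Transformation of
models (1)–(3) to 'non-compact', dual models by Fourier (-series) transformation", carried out in
§2.4 (2.19)–(2.24) and §2.7 (2.52)–(2.54)), for the tree's free-boundary Villain theory on the cube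
`B_n ⊆ ℤ^d` (`zdVillainMeasure β (halfOpenBox d n)`), in the PRIMAL language (fluxes `q = dm`
through the cubes of `B_n` instead of dual potentials): for a rectangular loop `γ` whose sheet `S`
lies in `B_n`,

  `⟨W_γ⟩_{B_n}(β) = exp(-E_n(S)/(2β)) · (∑_ξ g(ξ) cos(2π ⟨m(ξ)_⊥, S⟩)) / (∑_ξ g(ξ))`,

`ξ` running over the flux classes of integer plaquette fields `m` of `B_n` (`VillainFibre`:
`m ∼ m'` iff `m - m' = dℓ`; classes `↔` fluxes `q = dm`), `m(ξ)_⊥` the component of (any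
representative of) `ξ` orthogonal to the exact real plaquette fields `dℝ^{E¹_n}`,
`g(ξ) = exp(-2π²β ‖m(ξ)_⊥‖²)` the Coulomb (monopole-gas) weight, and
`E_n(S) = ⟨S, P_{exact} S⟩` the spin-wave (Gaussian) energy of the sheet
(`GaussianLinearImage.exactEnergy`; equal to the Coulomb energy `coulombEnergy` of
`U1CoulombEnergy`, which is `≤ C (R + T)` by `coulombEnergy_sheet_le`).

Steps, all proved here from tree files: the angle form of `⟨·⟩_{B_n}` (`VillainAngleIntegral`),
the expansion `∏ φ_β = ∑_m e^{-(β/2)‖dθ̃ + 2πm‖²}` (`VillainAngleForm`), Fubini, the resummation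
over the fibres `m = ξ.out + dℓ` (`VillainFibre.tsum_eq_tsum_tsum_fibre`), the unfolding
`∑_ℓ ∫_{[-π,π)^{E¹}} F(θ + 2πℓ) = ∫_{ℝ^{E¹}} F` (`PeriodicUnfolding`), and the Gaussian integral over
the injective linear image `θ ↦ dθ̃` (`GaussianLinearImage.integral_exp_quadratic_linear_image`).
No named fact is introduced.

## References

* J. Fröhlich, T. Spencer, Comm. Math. Phys. 83 (1982) 411–454, §2.1 (i), §2.4 (2.19)–(2.24),
  §2.7 (2.50)–(2.54). [FrohlichSpencerCMP1982]
-/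

noncomputable section

open MeasureTheory Measure Finset Function Set Matrix
open scoped ENNReal NNReal Real
open Literature.Probability.LatticeModels
open Literature.Probability.LatticeModels.GaussianCoord (gram exactPart perpPart exactPreimage exactEnergy)
open Literature.MathematicalPhysics.QuantumLattice (u1Rep continuous_u1Rep)
open Literature.MathematicalPhysics.QuantumFieldTheory.GaussianToolkit (gaussZ)

namespace Literature.MathematicalPhysics.QuantumFieldTheory

/-- Sites of `ℤ^d` (the namespace-local `Site` is the torus one). -/
local notation "ZSite" => Literature.Probability.LatticeModels.Site

namespace VillainAngle

open AxialGauge LatticeForm CircleHaar VillainFibre PeriodicUnfolding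

variable {d n : ℕ}

/-! ### The integrand as a sum of Gaussians with a phase -/

/-- **The Gaussian-with-phase** `H_σ(ψ) = e^{-(β/2)‖ψ‖²} cos⟨ψ, σ⟩` on real plaquette fields
(`σ = S` the sheet for the numerator, `σ = 0` for the partition function). [cite: FrohlichSpencerCMP1982, §2.4 (2.19)–(2.20)] -/
def gaussPhase (β : ℝ) (σ ψ : PIdx d n → ℝ) : ℝ :=
  Real.exp (-(β / 2) * (ψ ⬝ᵥ ψ)) * Real.cos (ψ ⬝ᵥ σ)

/-- `|H_σ(ψ)| ≤ e^{-(β/2)‖ψ‖²}`. [folklore] -/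
theorem abs_gaussPhase_le (β : ℝ) (σ ψ : PIdx d n → ℝ) :
    |gaussPhase β σ ψ| ≤ Real.exp (-(β / 2) * (ψ ⬝ᵥ ψ)) := by
  rw [gaussPhase, abs_mul, abs_of_pos (Real.exp_pos _)]
  exact mul_le_of_le_one_right (Real.exp_pos _).le (Real.abs_cos_le_one _)

/-- `H_σ` is continuous. [folklore] -/
theorem continuous_gaussPhase (β : ℝ) (σ : PIdx d n → ℝ) : Continuous (gaussPhase (d := d) (n := n) β σ) := by
  unfold gaussPhase
  fun_prop

/-- The phase is `2π`-periodic under integer shifts when `σ` is integer valued: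
`cos⟨ψ + 2πm, σ⟩ = cos⟨ψ, σ⟩`. [folklore] -/
theorem cos_dotProduct_add_intCast (ψ : PIdx d n → ℝ) (S m : PIdx d n → ℤ) :
    Real.cos ((ψ + (2 * Real.pi) • fun p => (m p : ℝ)) ⬝ᵥ fun p => (S p : ℝ)) =
      Real.cos (ψ ⬝ᵥ fun p => (S p : ℝ)) := by
  rw [add_dotProduct, smul_dotProduct, smul_eq_mul]
  have : (fun p => (m p : ℝ)) ⬝ᵥ (fun p => (S p : ℝ)) = ((∑ p, m p * S p : ℤ) : ℝ) := by
    simp [dotProduct]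
  rw [this, show ψ ⬝ᵥ (fun p => (S p : ℝ)) + 2 * Real.pi * ((∑ p, m p * S p : ℤ) : ℝ) =
    ψ ⬝ᵥ (fun p => (S p : ℝ)) + ((∑ p, m p * S p : ℤ)) * (2 * Real.pi) by ring,
    Real.cos_add_int_mul_two_pi]

/-- **The Villain weight times the Wilson-loop phase as a sum of Gaussians with phase**: for an
integer plaquette field `S` and `β > 0`,
`(∏_p φ_β(ω_p)) cos⟨ω, S⟩ = ∑_{m ∈ ℤ^P} H_S(ω + 2πm)`, absolutely convergent.
[cite: FrohlichSpencerCMP1982, §2.4 (2.19)–(2.20)] -/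
theorem prod_villainKernel_mul_cos_eq_tsum {β : ℝ} (hβ : 0 < β) (S : PIdx d n → ℤ)
    (ω : PIdx d n → ℝ) :
    Summable (fun m : PIdx d n → ℤ => gaussPhase β (fun p => (S p : ℝ))
        (ω + (2 * Real.pi) • fun p => (m p : ℝ))) ∧
      (∏ p, villainKernel β (ω p)) * Real.cos (ω ⬝ᵥ fun p => (S p : ℝ)) =
        ∑' m : PIdx d n → ℤ, gaussPhase β (fun p => (S p : ℝ)) (ω + (2 * Real.pi) • fun p => (m p : ℝ)) := by
  obtain ⟨hs, heq⟩ := prod_villainKernel_eq_tsum hβ ω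
  have hterm : ∀ m : PIdx d n → ℤ,
      gaussPhase β (fun p => (S p : ℝ)) (ω + (2 * Real.pi) • fun p => (m p : ℝ)) =
        Real.exp (-(β / 2) * ∑ p, (ω p + 2 * Real.pi * m p) ^ 2) * Real.cos (ω ⬝ᵥ fun p => (S p : ℝ)) := by
    intro m
    rw [gaussPhase, cos_dotProduct_add_intCast]
    congr 2
    simp only [dotProduct, Pi.add_apply, Pi.smul_apply, smul_eq_mul]
    congr 1
    exact Finset.sum_congr rfl fun p _ => by ring
  simp_rw [hterm]
  exact ⟨hs.mul_right _, by rw [heq, tsum_mul_right]⟩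

/-! ### Bounds -/

/-- `φ_β` is bounded: `φ_β(t) ≤ C_β` for all real `t` (`β > 0`). [folklore] -/
theorem exists_villainKernel_le {β : ℝ} (hβ : 0 < β) : ∃ C : ℝ, 0 < C ∧ ∀ t, villainKernel β t ≤ C := by
  obtain ⟨C, hC⟩ := exists_bound_of_continuous_circle (continuous_villainKernel_arg hβ)
  refine ⟨max C 1, by positivity, fun t => ?_⟩
  rw [← villainKernel_arg_exp β t]
  exact ((le_abs_self _).trans (hC _)).trans (le_max_left _ _)

variable {β : ℝ}

/-- The `m`-th Gaussian `e_m(ω) = exp(-(β/2) ∑_p (ω_p + 2π m_p)²)`. [folklore] -/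
def gaussTerm (β : ℝ) (m : PIdx d n → ℤ) (ω : PIdx d n → ℝ) : ℝ :=
  Real.exp (-(β / 2) * ∑ p, (ω p + 2 * Real.pi * m p) ^ 2)

/-- `|H_σ(ω + 2πm)| ≤ e_m(ω)`. [folklore] -/
theorem abs_gaussPhase_shift_le (β : ℝ) (σ ω : PIdx d n → ℝ) (m : PIdx d n → ℤ) :
    |gaussPhase β σ (ω + (2 * Real.pi) • fun p => (m p : ℝ))| ≤ gaussTerm β m ω := by
  refine (abs_gaussPhase_le β σ _).trans (le_of_eq ?_)
  rw [gaussTerm]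
  congr 2
  simp only [dotProduct, Pi.add_apply, Pi.smul_apply, smul_eq_mul]
  exact Finset.sum_congr rfl fun p _ => by ring

/-- `∑_m e_m(ω) = ∏_p φ_β(ω_p)` in `ℝ≥0∞` (`β > 0`). [folklore] -/
theorem tsum_ofReal_gaussTerm (hβ : 0 < β) (ω : PIdx d n → ℝ) :
    ∑' m : PIdx d n → ℤ, ENNReal.ofReal (gaussTerm β m ω) = ENNReal.ofReal (∏ p, villainKernel β (ω p)) := by
  obtain ⟨hs, heq⟩ := prod_villainKernel_eq_tsum hβ ω
  rw [heq, ENNReal.ofReal_tsum_of_nonneg (fun m => (Real.exp_pos _).le) hs]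
  rfl

/-- `∏_p φ_β(ω_p) ≤ C_β^{|P|}`. [folklore] -/
theorem prod_villainKernel_le (hβ : 0 < β) {C : ℝ} (hC : ∀ t, villainKernel β t ≤ C)
    (ω : PIdx d n → ℝ) : ∏ p, villainKernel β (ω p) ≤ C ^ Fintype.card (PIdx d n) := by
  rw [← Finset.card_univ, ← Finset.prod_const]
  exact Finset.prod_le_prod (fun p _ => (villainKernel_pos hβ _).le) fun p _ => hC _

/-! ### Step A–B: Fubini and the resummation over the fibres of the flux map -/

/-- The box `[-π, π)^{E¹_n}` of free link angles. [folklore] -/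
def angleBox (d n : ℕ) : Set (FIdx d n → ℝ) := Set.pi univ fun _ => Ico (-Real.pi) Real.pi

/-- The angle box has finite Lebesgue measure. [folklore] -/
theorem volume_angleBox_lt_top : volume (angleBox d n) < ⊤ := by
  refine Bornology.IsBounded.measure_lt_top ?_
  refine (Metric.isBounded_Icc (fun _ => -Real.pi : FIdx d n → ℝ) (fun _ => Real.pi)).subset ?_
  intro θ hθ
  simp only [angleBox, Set.mem_pi, Set.mem_univ, forall_const, Set.mem_Ico] at hθ
  exact ⟨fun e => (hθ e).1, fun e => (hθ e).2.le⟩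

/-- `dFreeR` is continuous. [folklore] -/
theorem continuous_dFreeR : Continuous (dFreeR (d := d) (n := n)) :=
  LinearMap.continuous_of_finiteDimensional _

/-- The `m`-th term `θ ↦ H_σ(dθ̃ + 2πm)` of the integrand. [folklore] -/
def angleTerm (β : ℝ) (σ : PIdx d n → ℝ) (m : PIdx d n → ℤ) (θ : FIdx d n → ℝ) : ℝ :=
  gaussPhase β σ (dFreeR θ + (2 * Real.pi) • fun p => (m p : ℝ))

/-- Each term is continuous. [folklore] -/
theorem continuous_angleTerm (β : ℝ) (σ : PIdx d n → ℝ) (m : PIdx d n → ℤ) :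
    Continuous (angleTerm (d := d) (n := n) β σ m) :=
  (continuous_gaussPhase β σ).comp (continuous_dFreeR.add continuous_const)

/-- The majorants `θ ↦ e_m(dθ̃)` are continuous. [folklore] -/
theorem continuous_gaussTerm_dFreeR (β : ℝ) (m : PIdx d n → ℤ) :
    Continuous fun θ : FIdx d n → ℝ => gaussTerm β m (dFreeR θ) := by
  unfold gaussTerm
  fun_prop [continuous_dFreeR]

/-- **The key finiteness**: `∑_m ∫_{box} e_m(dθ̃) dθ < ∞` (Tonelli and the bound `∏ φ_β ≤ C^{|P|}`).
[folklore] -/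
theorem tsum_lintegral_gaussTerm_lt_top (hβ : 0 < β) :
    ∑' m : PIdx d n → ℤ, ∫⁻ θ in angleBox d n, ENNReal.ofReal (gaussTerm β m (dFreeR θ)) < ⊤ := by
  obtain ⟨C, hC0, hC⟩ := exists_villainKernel_le hβ
  rw [← lintegral_tsum fun m =>
    ((continuous_gaussTerm_dFreeR β m).measurable.ennreal_ofReal).aemeasurable]
  simp_rw [tsum_ofReal_gaussTerm hβ]
  calc ∫⁻ θ in angleBox d n, ENNReal.ofReal (∏ p, villainKernel β (dFreeR θ p))
      ≤ ∫⁻ _ in angleBox d n, ENNReal.ofReal (C ^ Fintype.card (PIdx d n)) :=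
        lintegral_mono fun θ => ENNReal.ofReal_le_ofReal (prod_villainKernel_le hβ hC _)
    _ < ⊤ := by
        rw [setLIntegral_const]
        exact ENNReal.mul_lt_top ENNReal.ofReal_lt_top volume_angleBox_lt_top

/-- `∑_m ∫_{box} ‖H_σ(dθ̃ + 2πm)‖ₑ dθ < ∞`. [folklore] -/
theorem tsum_lintegral_enorm_angleTerm_lt_top (hβ : 0 < β) (σ : PIdx d n → ℝ) :
    ∑' m : PIdx d n → ℤ, ∫⁻ θ in angleBox d n, ‖angleTerm β σ m θ‖ₑ < ⊤ := by
  refine lt_of_le_of_lt (ENNReal.tsum_le_tsum fun m => lintegral_mono fun θ => ?_)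
    (tsum_lintegral_gaussTerm_lt_top hβ)
  rw [← ofReal_norm, Real.norm_eq_abs]
  exact ENNReal.ofReal_le_ofReal (abs_gaussPhase_shift_le β σ _ m)

/-- **The box integral of the `m`-th term**, `Φ_σ(m) = ∫_{[-π,π)^{E¹}} H_σ(dθ̃ + 2πm) dθ`.
[cite: FrohlichSpencerCMP1982, §2.4 (2.19)–(2.20)] -/
def boxIntegral (β : ℝ) (σ : PIdx d n → ℝ) (m : PIdx d n → ℤ) : ℝ :=
  ∫ θ in angleBox d n, angleTerm β σ m θ

/-- The majorant `e_m(dθ̃)` is integrable on the box. [folklore] -/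
theorem integrableOn_gaussTerm (hβ : 0 ≤ β) (m : PIdx d n → ℤ) :
    IntegrableOn (fun θ : FIdx d n → ℝ => gaussTerm β m (dFreeR θ)) (angleBox d n) := by
  refine Measure.integrableOn_of_bounded (M := 1) volume_angleBox_lt_top.ne
    (continuous_gaussTerm_dFreeR β m).aestronglyMeasurable (Filter.Eventually.of_forall fun θ => ?_)
  rw [Real.norm_eq_abs, gaussTerm, abs_of_pos (Real.exp_pos _), Real.exp_le_one_iff]
  have : 0 ≤ ∑ p, (dFreeR θ p + 2 * Real.pi * m p) ^ 2 := Finset.sum_nonneg fun p _ => sq_nonneg _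
  nlinarith

/-- `‖Φ_σ(m)‖ ≤ ∫_{box} e_m(dθ̃)`. [folklore] -/
theorem norm_boxIntegral_le (hβ : 0 ≤ β) (σ : PIdx d n → ℝ) (m : PIdx d n → ℤ) :
    ‖boxIntegral β σ m‖ ≤ (∫⁻ θ in angleBox d n, ENNReal.ofReal (gaussTerm β m (dFreeR θ))).toReal := by
  rw [boxIntegral, ← integral_eq_lintegral_of_nonneg_ae (f := fun θ => gaussTerm β m (dFreeR θ))
    (Filter.Eventually.of_forall fun θ => (Real.exp_pos _).le)
    (continuous_gaussTerm_dFreeR β m).aestronglyMeasurable]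
  exact norm_integral_le_of_norm_le (integrableOn_gaussTerm hβ m)
    (Filter.Eventually.of_forall fun θ => by
      rw [Real.norm_eq_abs]; exact abs_gaussPhase_shift_le β σ _ m)

/-- **The box integrals are absolutely summable over `m ∈ ℤ^P`.** [folklore] -/
theorem summable_norm_boxIntegral (hβ : 0 < β) (σ : PIdx d n → ℝ) :
    Summable fun m : PIdx d n → ℤ => ‖boxIntegral β σ m‖ :=
  Summable.of_nonneg_of_le (fun _ => norm_nonneg _) (fun m => norm_boxIntegral_le hβ.le σ m)
    (ENNReal.summable_toReal (tsum_lintegral_gaussTerm_lt_top hβ).ne)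

/-- **Step A (Fubini)**: `∫_{box} ∑_m H_σ(dθ̃ + 2πm) dθ = ∑_m Φ_σ(m)`. [cite: FrohlichSpencerCMP1982, §2.4 (2.19)–(2.20)] -/
theorem setIntegral_tsum_angleTerm (hβ : 0 < β) (σ : PIdx d n → ℝ) :
    ∫ θ in angleBox d n, ∑' m : PIdx d n → ℤ, angleTerm β σ m θ = ∑' m : PIdx d n → ℤ, boxIntegral β σ m :=
  integral_tsum (fun m => (continuous_angleTerm β σ m).aestronglyMeasurable)
    (tsum_lintegral_enorm_angleTerm_lt_top hβ σ).ne

/-- **Step B (resummation over the fibres of the flux map)**: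
`∑_m Φ_σ(m) = ∑_ξ ∑_{ℓ ∈ ℤ^{E¹}} Φ_σ(ξ.out + dℓ)`. [cite: FrohlichSpencerCMP1982, §2.4 (2.21)–(2.24)] -/
theorem tsum_boxIntegral_eq_fibre (hβ : 0 < β) (σ : PIdx d n → ℝ) :
    ∑' m : PIdx d n → ℤ, boxIntegral β σ m =
      ∑' ξ : (PIdx d n → ℤ) ⧸ (dFree (d := d) (n := n)).range,
        ∑' ℓ : FreeInt d n, boxIntegral β σ (ξ.out + dFree ℓ) :=
  tsum_eq_tsum_tsum_fibre _ (summable_norm_boxIntegral hβ σ)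

/-! ### Step C–D: unfolding the fibre sum and the Gaussian integral -/

/-- Translating the angles by `2πℓ` shifts the term index by `dℓ`:
`H_σ(dθ̃ + 2π(m₀ + dℓ)) = H_σ(d(θ + 2πℓ)̃ + 2πm₀)`. [folklore] -/
theorem angleTerm_add_dFree (β : ℝ) (σ : PIdx d n → ℝ) (m₀ : PIdx d n → ℤ) (ℓ : FreeInt d n)
    (θ : FIdx d n → ℝ) :
    angleTerm β σ (m₀ + dFree ℓ) θ = angleTerm β σ m₀ (θ + PeriodicUnfolding.shift ℓ) := by
  simp only [angleTerm, dFreeR_add_shift]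
  congr 1
  funext p
  simp only [Pi.add_apply, Pi.smul_apply, smul_eq_mul, Int.cast_add]
  ring

/-- `dφ̃ + 2πm₀ = T(φ + φ_w) + w_⊥` with `T = dMat`, `w = 2πm₀`. [folklore] -/
theorem dFreeR_add_eq (m₀ : PIdx d n → ℤ) (φ : FIdx d n → ℝ) :
    dFreeR φ + (2 * Real.pi) • (fun p => (m₀ p : ℝ)) =
      dMat *ᵥ (φ + exactPreimage dMat ((2 * Real.pi) • fun p => (m₀ p : ℝ))) +
        perpPart dMat ((2 * Real.pi) • fun p => (m₀ p : ℝ)) := by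
  rw [← GaussianCoord.mulVec_sub_exactPreimage_add, add_sub_cancel_right, dMat_mulVec]

/-- The Gaussian majorant of the term on `ℝ^{E¹}`:
`|H_σ(dφ̃ + 2πm₀)| ≤ e^{-(β/2)‖w_⊥‖²} e^{-½ (φ+φ_w)ᵀ(βM)(φ+φ_w)}`. [folklore] -/
theorem abs_angleTerm_le (σ : PIdx d n → ℝ) (m₀ : PIdx d n → ℤ) (φ : FIdx d n → ℝ) :
    |angleTerm β σ m₀ φ| ≤
      Real.exp (-(β / 2) * (perpPart dMat ((2 * Real.pi) • fun p => (m₀ p : ℝ)) ⬝ᵥ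
          perpPart dMat ((2 * Real.pi) • fun p => (m₀ p : ℝ)))) *
        Real.exp (-((φ + exactPreimage dMat ((2 * Real.pi) • fun p => (m₀ p : ℝ))) ⬝ᵥ
          (β • gram dMat) *ᵥ (φ + exactPreimage dMat ((2 * Real.pi) • fun p => (m₀ p : ℝ)))) / 2) := by
  rw [angleTerm]
  refine (abs_gaussPhase_le β σ _).trans (le_of_eq ?_)
  rw [dFreeR_add_eq, GaussianCoord.norm_sq_mulVec_add_perpPart _ posDef_gram_dMat, ← Real.exp_add,
    Matrix.smul_mulVec, dotProduct_smul, smul_eq_mul]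
  congr 1
  ring

/-- **The term is integrable on `ℝ^{E¹}`** (Gaussian majorant; `T` injective). [folklore] -/
theorem integrable_angleTerm (hβ : 0 < β) (σ : PIdx d n → ℝ) (m₀ : PIdx d n → ℤ) :
    Integrable (angleTerm β σ m₀) := by
  have hP : (β • gram (dMat (d := d) (n := n))).PosDef := posDef_gram_dMat.smul hβ
  have hg := ((GaussianCoord.integrable_exp_quadratic _ hP).comp_add_right
    (exactPreimage dMat ((2 * Real.pi) • fun p => (m₀ p : ℝ)))).const_mul
    (Real.exp (-(β / 2) * (perpPart dMat ((2 * Real.pi) • fun p => (m₀ p : ℝ)) ⬝ᵥ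
      perpPart dMat ((2 * Real.pi) • fun p => (m₀ p : ℝ)))))
  refine hg.mono' (continuous_angleTerm β σ m₀).aestronglyMeasurable
    (Filter.Eventually.of_forall fun φ => ?_)
  rw [Real.norm_eq_abs]
  exact abs_angleTerm_le σ m₀ φ

/-- **Step C (unfolding)**: `∑_ℓ Φ_σ(m₀ + dℓ) = ∫_{ℝ^{E¹}} H_σ(dφ̃ + 2πm₀) dφ`.
[cite: FrohlichSpencerCMP1982, §2.1 (i), §2.4 (2.19)–(2.24)] -/
theorem tsum_boxIntegral_add_dFree (hβ : 0 < β) (σ : PIdx d n → ℝ) (m₀ : PIdx d n → ℤ) :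
    ∑' ℓ : FreeInt d n, boxIntegral β σ (m₀ + dFree ℓ) = ∫ φ, angleTerm β σ m₀ φ := by
  rw [PeriodicUnfolding.integral_eq_tsum_setIntegral_box_add _ (integrable_angleTerm hβ σ m₀)]
  refine tsum_congr fun ℓ => ?_
  rw [boxIntegral]
  exact setIntegral_congr_fun (by unfold angleBox; exact MeasurableSet.univ_pi fun _ => measurableSet_Ico)
    fun θ _ => angleTerm_add_dFree β σ m₀ ℓ θ

/-- **Step D (the Gaussian integral)**:
`∫_{ℝ^{E¹}} H_σ(dφ̃ + 2πm₀) dφ = Z_{βM} e^{-(β/2)‖w_⊥‖²} e^{-E_T(σ)/(2β)} cos⟨w_⊥, σ⟩`, `w = 2πm₀`,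
`T = dMat`, `M = TᵀT` (`GaussianLinearImage.integral_exp_quadratic_linear_image`).
[cite: FrohlichSpencerCMP1982, §2.5 (2.33), §2.7 (2.52)–(2.54)] -/
theorem integral_angleTerm (hβ : 0 < β) (σ : PIdx d n → ℝ) (m₀ : PIdx d n → ℤ) :
    ∫ φ, angleTerm β σ m₀ φ =
      (gaussZ (β • gram (dMat (d := d) (n := n)))).toReal *
        Real.exp (-(β / 2) * (perpPart dMat ((2 * Real.pi) • fun p => (m₀ p : ℝ)) ⬝ᵥ
          perpPart dMat ((2 * Real.pi) • fun p => (m₀ p : ℝ)))) *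
        Real.exp (-(exactEnergy dMat σ) / (2 * β)) *
        Real.cos (perpPart dMat ((2 * Real.pi) • fun p => (m₀ p : ℝ)) ⬝ᵥ σ) := by
  set w : PIdx d n → ℝ := (2 * Real.pi) • fun p => (m₀ p : ℝ) with hw
  -- the complex integrand
  set f : (FIdx d n → ℝ) → ℂ := fun φ =>
    (Real.exp (-(β / 2) * ((dMat *ᵥ φ + w) ⬝ᵥ (dMat *ᵥ φ + w))) : ℂ) *
      Complex.exp (Complex.I * (((dMat *ᵥ φ + w) ⬝ᵥ σ : ℝ) : ℂ)) with hf
  have hre : ∀ φ, angleTerm β σ m₀ φ = (f φ).re := by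
    intro φ
    rw [hf]
    simp only
    rw [angleTerm, gaussPhase, ← dMat_mulVec, Complex.re_ofReal_mul, mul_comm Complex.I,
      Complex.exp_ofReal_mul_I_re]
  have hnorm : ∀ φ, ‖f φ‖ = Real.exp (-(β / 2) * ((dMat *ᵥ φ + w) ⬝ᵥ (dMat *ᵥ φ + w))) := by
    intro φ
    rw [hf]
    simp only
    rw [norm_mul, Complex.norm_real, Real.norm_eq_abs, abs_of_pos (Real.exp_pos _), mul_comm Complex.I,
      Complex.norm_exp_ofReal_mul_I, mul_one]
  have hfi : Integrable f := by
    have hP : (β • gram (dMat (d := d) (n := n))).PosDef := posDef_gram_dMat.smul hβ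
    have hg := ((GaussianCoord.integrable_exp_quadratic _ hP).comp_add_right
      (exactPreimage dMat w)).const_mul (Real.exp (-(β / 2) * (perpPart dMat w ⬝ᵥ perpPart dMat w)))
    refine hg.mono' ?_ (Filter.Eventually.of_forall fun φ => ?_)
    · rw [hf]; fun_prop
    · rw [hnorm, hw, dMat_mulVec, dFreeR_add_eq, GaussianCoord.norm_sq_mulVec_add_perpPart _ posDef_gram_dMat,
        ← Real.exp_add, Matrix.smul_mulVec, dotProduct_smul, smul_eq_mul]
      exact le_of_eq (congrArg Real.exp (by ring))
  calc ∫ φ, angleTerm β σ m₀ φ = ∫ φ, (f φ).re := integral_congr_ae (Filter.Eventually.of_forall hre)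
    _ = (∫ φ, f φ).re := integral_re hfi
    _ = _ := by
      rw [hf, GaussianCoord.integral_exp_quadratic_linear_image dMat posDef_gram_dMat hβ w σ]
      have h1 : Complex.exp (-((exactEnergy dMat σ : ℝ) : ℂ) / (2 * β)) =
          ((Real.exp (-(exactEnergy dMat σ) / (2 * β)) : ℝ) : ℂ) := by
        rw [Complex.ofReal_exp]; push_cast; ring_nf
      rw [h1, mul_comm Complex.I, show (((gaussZ (β • gram dMat)).toReal : ℝ) : ℂ) *
          ((Real.exp (-(β / 2) * (perpPart dMat w ⬝ᵥ perpPart dMat w)) : ℝ) : ℂ) *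
          Complex.exp (((perpPart dMat w ⬝ᵥ σ : ℝ) : ℂ) * Complex.I) *
          ((Real.exp (-(exactEnergy dMat σ) / (2 * β)) : ℝ) : ℂ) =
        (((gaussZ (β • gram dMat)).toReal * Real.exp (-(β / 2) * (perpPart dMat w ⬝ᵥ perpPart dMat w)) *
          Real.exp (-(exactEnergy dMat σ) / (2 * β)) : ℝ) : ℂ) *
          Complex.exp (((perpPart dMat w ⬝ᵥ σ : ℝ) : ℂ) * Complex.I) by push_cast; ring,
        Complex.re_ofReal_mul, Complex.exp_ofReal_mul_I_re]

/-! ### The duality formula -/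

/-- The scaled representative `2π ξ.out` of a flux class, as a real plaquette field. [folklore] -/
def fluxRep (ξ : (PIdx d n → ℤ) ⧸ (dFree (d := d) (n := n)).range) : PIdx d n → ℝ :=
  (2 * Real.pi) • fun p => (ξ.out p : ℝ)

/-- **The Coulomb (monopole-gas) weight of a flux class**: `g(ξ) = Z_{βM} e^{-(β/2)‖(2π ξ.out)_⊥‖²}`
(`= Z e^{-2π²β (q, (d d*)⁻¹ q)}`, `q` the flux of `ξ`). [cite: FrohlichSpencerCMP1982, §2.4 (2.24)] -/
def coulombWeight (β : ℝ) (ξ : (PIdx d n → ℤ) ⧸ (dFree (d := d) (n := n)).range) : ℝ :=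
  (gaussZ (β • gram (dMat (d := d) (n := n)))).toReal *
    Real.exp (-(β / 2) * (perpPart dMat (fluxRep ξ) ⬝ᵥ perpPart dMat (fluxRep ξ)))

/-- The Coulomb weights are positive. [folklore] -/
theorem coulombWeight_pos (hβ : 0 < β) (ξ : (PIdx d n → ℤ) ⧸ (dFree (d := d) (n := n)).range) :
    0 < coulombWeight β ξ :=
  mul_pos (GaussianCoord.gaussZ_toReal_pos _ (posDef_gram_dMat.smul hβ)) (Real.exp_pos _)

/-- **The numerator/denominator of the duality formula**: for `β > 0` and a real `σ`,
`∫_{[-π,π)^{E¹}} ∑_m H_σ(dθ̃ + 2πm) dθ = e^{-E_T(σ)/(2β)} ∑_ξ g(ξ) cos⟨(2πξ.out)_⊥, σ⟩`, the series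
converging absolutely. [cite: FrohlichSpencerCMP1982, §2.4 (2.24), §2.7 (2.52)–(2.54)] -/
theorem setIntegral_tsum_angleTerm_eq (hβ : 0 < β) (σ : PIdx d n → ℝ) :
    Summable (fun ξ : (PIdx d n → ℤ) ⧸ (dFree (d := d) (n := n)).range =>
        coulombWeight β ξ * Real.cos (perpPart dMat (fluxRep ξ) ⬝ᵥ σ)) ∧
      ∫ θ in angleBox d n, ∑' m : PIdx d n → ℤ, angleTerm β σ m θ =
        Real.exp (-(exactEnergy dMat σ) / (2 * β)) *
          ∑' ξ : (PIdx d n → ℤ) ⧸ (dFree (d := d) (n := n)).range,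
            coulombWeight β ξ * Real.cos (perpPart dMat (fluxRep ξ) ⬝ᵥ σ) := by
  have hinner : ∀ ξ : (PIdx d n → ℤ) ⧸ (dFree (d := d) (n := n)).range,
      ∑' ℓ : FreeInt d n, boxIntegral β σ (ξ.out + dFree ℓ) =
        Real.exp (-(exactEnergy dMat σ) / (2 * β)) *
          (coulombWeight β ξ * Real.cos (perpPart dMat (fluxRep ξ) ⬝ᵥ σ)) := by
    intro ξ
    rw [tsum_boxIntegral_add_dFree hβ, integral_angleTerm hβ, coulombWeight, fluxRep]
    ring
  -- summability of the outer family, from the absolute summability over `m`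
  have hsum : Summable fun ξ : (PIdx d n → ℤ) ⧸ (dFree (d := d) (n := n)).range =>
      ∑' ℓ : FreeInt d n, boxIntegral β σ (ξ.out + dFree ℓ) := by
    have h1 : Summable fun q : ((PIdx d n → ℤ) ⧸ (dFree (d := d) (n := n)).range) × FreeInt d n =>
        boxIntegral β σ ((fibreEquiv (d := d) (n := n)).symm q) :=
      Summable.of_norm ((Equiv.summable_iff (fibreEquiv (d := d) (n := n)).symm
        (f := fun m => ‖boxIntegral β σ m‖)).2 (summable_norm_boxIntegral hβ σ))
    simpa only [fibreEquiv_symm_apply] using h1.prod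
  simp_rw [hinner] at hsum
  refine ⟨(summable_mul_left_iff (Real.exp_pos _).ne').1 hsum, ?_⟩
  rw [setIntegral_tsum_angleTerm hβ, tsum_boxIntegral_eq_fibre hβ]
  simp_rw [hinner]
  exact tsum_mul_left

/-- The integrand of the angle form as the series of the terms: for an integer plaquette field
`S`, `(∏_p φ_β((dθ̃)_p)) cos⟨dθ̃, S⟩ = ∑_m H_S(dθ̃ + 2πm)`. [folklore] -/
theorem prod_villainKernel_mul_cos_eq_tsum_angleTerm (hβ : 0 < β) (S : PIdx d n → ℤ)
    (θ : FIdx d n → ℝ) :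
    (∏ p, villainKernel β (dFreeR θ p)) * Real.cos (dFreeR θ ⬝ᵥ fun p => (S p : ℝ)) =
      ∑' m : PIdx d n → ℤ, angleTerm β (fun p => (S p : ℝ)) m θ :=
  (prod_villainKernel_mul_cos_eq_tsum hβ S (dFreeR θ)).2

/-- The sheet of the loop as an integer plaquette field on the index type. [folklore] -/
def sheetIdx (x : ZSite d) (i j : Fin d) (R T : ℕ) : PIdx d n → ℤ :=
  fun p => if (p : Plaq d) ∈ rectPlaqs x i j R T then 1 else 0

/-- `∑_{p ∈ S_γ} (dθ̃)_p = ⟨dθ̃, S⟩` when the sheet lies in `B_n`. [folklore] -/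
theorem sum_rectPlaqs_eq_dotProduct {x : ZSite d} {i j : Fin d} {R T : ℕ}
    (hsub : rectPlaqs x i j R T ⊆ plaquettesIn (halfOpenBox d n)) (θ : FIdx d n → ℝ) :
    ∑ p ∈ rectPlaqs x i j R T, d₁ (extAngle θ) p.1 p.2.1 p.2.2 =
      dFreeR θ ⬝ᵥ fun p => (sheetIdx (n := n) x i j R T p : ℝ) := by
  classical
  symm
  rw [dotProduct]
  have h : ∀ q : PIdx d n, dFreeR θ q * (sheetIdx (n := n) x i j R T q : ℝ) =
      (fun p : Plaq d => if p ∈ rectPlaqs x i j R T then d₁ (extAngle θ) p.1 p.2.1 p.2.2 else 0) q := by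
    intro q
    simp only [sheetIdx, dFreeR_apply]
    split_ifs <;> simp
  simp_rw [h]
  rw [Finset.sum_coe_sort (plaquettesIn (halfOpenBox d n))
    (fun p : Plaq d => if p ∈ rectPlaqs x i j R T then d₁ (extAngle θ) p.1 p.2.1 p.2.2 else 0),
    Finset.sum_ite_mem, Finset.inter_eq_right.2 hsub]

/-- **The duality transformation of the Villain Wilson loop on a cube** (Fröhlich–Spencer's
"transformation to the non-compact, dual model", in the primal flux language): for `β > 0` and a
rectangular loop in the `(i, j)` plane, `i ≠ j`, whose sheet `S` lies in `B_n`,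

`⟨W_γ⟩_{B_n}(β) = e^{-E_n(S)/(2β)} · (∑_ξ g(ξ) cos⟨(2πξ.out)_⊥, S⟩) / (∑_ξ g(ξ))`,

`ξ` over the flux classes of integer plaquette fields of `B_n` (`VillainFibre`), `g` the Coulomb
weights (`coulombWeight`), `E_n(S) = exactEnergy dMat S` the spin-wave energy of the sheet and
`(·)_⊥ = perpPart dMat` the component orthogonal to the exact real plaquette fields.
[cite: FrohlichSpencerCMP1982, §2.4 (2.24) and §2.7 (2.52)–(2.54)] -/
theorem zdVillainExpect_wilsonLoop_eq_dual (hβ : 0 < β) {x : ZSite d} {i j : Fin d} (hij : i ≠ j)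
    {R T : ℕ} (hsub : rectPlaqs x i j R T ⊆ plaquettesIn (halfOpenBox d n)) :
    zdVillainExpect β (halfOpenBox d n) (zdWilsonLoop u1Rep x i j R T) =
      Real.exp (-(exactEnergy dMat (fun p => (sheetIdx (n := n) x i j R T p : ℝ))) / (2 * β)) *
        (∑' ξ : (PIdx d n → ℤ) ⧸ (dFree (d := d) (n := n)).range,
            coulombWeight β ξ *
              Real.cos (perpPart dMat (fluxRep ξ) ⬝ᵥ fun p => (sheetIdx (n := n) x i j R T p : ℝ))) /
          ∑' ξ : (PIdx d n → ℤ) ⧸ (dFree (d := d) (n := n)).range, coulombWeight β ξ := by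
  set σ : PIdx d n → ℝ := fun p => (sheetIdx (n := n) x i j R T p : ℝ) with hσ
  have hWm : Measurable (zdWilsonLoop (d := d) u1Rep x i j R T) :=
    (AreaLaw.continuous_zdWilsonLoop u1Rep continuous_u1Rep x i j R T).measurable
  rw [zdVillainExpect_eq_angle_ratio hβ _ hWm (fun U => (zdWilsonLoop_u1_ext_restrict x hij hsub U).symm)
    (zdWilsonLoop_u1_ext_gaugeFixBox x hij hsub)]
  -- the integrands as series of the terms
  have hnum : ∀ θ : FIdx d n → ℝ,
      (∏ p ∈ plaquettesIn (halfOpenBox d n), villainKernel β (d₁ (extAngle θ) p.1 p.2.1 p.2.2)) *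
          zdWilsonLoop u1Rep x i j R T (cfgOfAngle θ) =
        ∑' m : PIdx d n → ℤ, angleTerm β σ m θ := by
    intro θ
    rw [zdWilsonLoop_cfgOfAngle θ x hij, sum_rectPlaqs_eq_dotProduct hsub, ← Finset.prod_coe_sort]
    exact prod_villainKernel_mul_cos_eq_tsum_angleTerm hβ _ θ
  have hden : ∀ θ : FIdx d n → ℝ,
      (∏ p ∈ plaquettesIn (halfOpenBox d n), villainKernel β (d₁ (extAngle θ) p.1 p.2.1 p.2.2)) =
        ∑' m : PIdx d n → ℤ, angleTerm β (0 : PIdx d n → ℝ) m θ := by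
    intro θ
    have h := prod_villainKernel_mul_cos_eq_tsum_angleTerm hβ (0 : PIdx d n → ℤ) θ
    have h0 : (fun p : PIdx d n => (((0 : PIdx d n → ℤ) p : ℤ) : ℝ)) = 0 := by
      funext p; simp
    rw [h0, dotProduct_zero, Real.cos_zero, mul_one] at h
    simp only [dFreeR_apply] at h
    rw [Finset.prod_coe_sort (plaquettesIn (halfOpenBox d n))
      (fun p : Plaq d => villainKernel β (d₁ (extAngle θ) p.1 p.2.1 p.2.2))] at h
    rw [h]
  simp_rw [hnum, hden]
  rw [setIntegral_pi_Ioc_eq_pi_Ico, setIntegral_pi_Ioc_eq_pi_Ico]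
  change (∫ θ in angleBox d n, _) / (∫ θ in angleBox d n, _) = _
  rw [(setIntegral_tsum_angleTerm_eq hβ σ).2, (setIntegral_tsum_angleTerm_eq hβ 0).2]
  have hE0 : exactEnergy (dMat (d := d) (n := n)) 0 = 0 := by simp [exactEnergy]
  simp only [hE0, neg_zero, zero_div, Real.exp_zero, one_mul, dotProduct_zero, Real.cos_zero, mul_one]

end VillainAngle

end Literature.MathematicalPhysics.QuantumFieldTheory
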